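import Mathlib
import Literature.NumberTheory.Transcendental.SchanuelEclEmptyProofs

/-!
# The horizontal split: Schanuel on an `exp`-closed base plus relative Schanuel over it

Crux `stmt-Schanuel-0970` (`Summit.Schanuel.Schanuel.Theses.RigidCore.SchanuelOnLogFreeCore`,
Schanuel's conjecture for tuples from the log-free core `C_EA`), line `generic-period-fibre`.
The line splits the crux as `A ∧ B ⟹ (R)` along the kernel-free core `M ≤ C_EA`; the split is an
instance of the following GENERAL theorem, registered as stub `stub_horizontalSplit` (S1a) and
proved here sorry-free:

* `HorizontalSplit.schanuelOn_of_relSchanuel` — for intermediate fields `M, L` of `ℂ/ℚ` with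
  `M` closed under `exp`: Schanuel's statement for `ℚ`-linearly independent tuples from `M`
  ("Schanuel on `M`") together with RELATIVE Schanuel of `L` over `M` (tuples from `L` that are
  `ℚ`-linearly independent modulo `M` have `n ≤ trdeg_M M(x, eˣ)`) give Schanuel's statement for
  `ℚ`-linearly independent tuples from `L`.

Proof (the architecture of Kirby's reduction `SC ⟺ SC on ecl ∅`, tree
`Literature.NumberTheory.Transcendental.schanuelConjecture_iff_ecl_empty_of_kirby`, J. Kirby,
*Exponential algebraicity in exponential fields*, Bull. LMS 42 (2010), arXiv:0810.4285, Prop. 7.2,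
with the base `ℚ(ecl ∅)` replaced by an arbitrary `exp`-closed intermediate field `M`): choose an
adapted decomposition `span_ℚ x = (span_ℚ x ∩ M) ⊕ U`, bases `y` of the first summand and `z` of
the second, clear denominators so that `y', z'` lie in the `ℤ`-span of `x` (then `y', e^{y'}, z',
e^{z'} ∈ ℚ(x, eˣ)`), apply Schanuel on `M` to `y'` (`k ≤ trdeg ℚ(y', e^{y'})`) and relative
Schanuel to `z'`, which is independent modulo `M` (`m ≤ trdeg_M M(z', e^{z'})`), move the second
estimate down to the base `ℚ(y', e^{y'}) ≤ M` (base change only raises a relative transcendence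
degree, `trdeg_adjoin_le_of_le`), add by the tower law (`add_le_trdeg_adjoin_union`) and compare
with `ℚ(x, eˣ)`; `k + m = n` by the dimension count.

This file closes nothing by itself; it is the landed form of the line's glue `horizontalSplit`.
-/

noncomputable section

namespace Summit.Schanuel.Schanuel.Theorems.RigidCore

open Complex IntermediateField Submodule
open Literature.NumberTheory.Transcendental

namespace HorizontalSplit

/-- **The horizontal split (general form).** For intermediate fields `M, L` of `ℂ/ℚ` with `M`
closed under `exp`: Schanuel on `M` and relative Schanuel of `L` over `M` give Schanuel on `L`
(J. Kirby, Bull. LMS 42 (2010), Prop. 7.2, with `ℚ(ecl ∅)` replaced by `M`). -/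
theorem schanuelOn_of_relSchanuel {M L : IntermediateField ℚ ℂ}
    (hMexp : ∀ w ∈ M, Complex.exp w ∈ M)
    (hA : ∀ (n : ℕ) (x : Fin n → ℂ), (∀ i, x i ∈ M) → LinearIndependent ℚ x →
      (n : Cardinal) ≤ Algebra.trdeg ℚ
        ↥(IntermediateField.adjoin ℚ (Set.range x ∪ Set.range (Complex.exp ∘ x))))
    (hB : ∀ (n : ℕ) (x : Fin n → ℂ), (∀ i, x i ∈ L) →
      LinearIndependent ℚ ((Submodule.span ℚ (M : Set ℂ)).mkQ ∘ x) →
        (n : Cardinal) ≤ Algebra.trdeg ↥M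
          ↥(IntermediateField.adjoin ↥M (Set.range x ∪ Set.range (Complex.exp ∘ x))))
    (n : ℕ) (x : Fin n → ℂ) (hxL : ∀ i, x i ∈ L) (hx : LinearIndependent ℚ x) :
    (n : Cardinal) ≤ Algebra.trdeg ℚ
      ↥(IntermediateField.adjoin ℚ (Set.range x ∪ Set.range (Complex.exp ∘ x))) := by
  -- `M` and `L` as `ℚ`-subspaces of `ℂ`
  let Eq : Submodule ℚ ℂ := Subalgebra.toSubmodule M.toSubalgebra
  have hEq : (Eq : Set ℂ) = (M : Set ℂ) := rfl
  have hspanE : span ℚ (M : Set ℂ) = Eq := by rw [← hEq, span_eq]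
  let Lq : Submodule ℚ ℂ := Subalgebra.toSubmodule L.toSubalgebra
  -- the `ℚ`-span `V` of `x̄`, `W = V ∩ M` and a complement `U` of `W` in `V`
  set V : Submodule ℚ ℂ := span ℚ (Set.range x) with hV
  have hVL : V ≤ Lq := span_le.mpr (Set.range_subset_iff.mpr hxL)
  haveI : FiniteDimensional ℚ V := FiniteDimensional.span_of_finite ℚ (Set.finite_range x)
  set W : Submodule ℚ ℂ := V ⊓ Eq with hW
  obtain ⟨U', hU'⟩ := W.exists_isCompl
  set U : Submodule ℚ ℂ := V ⊓ U' with hU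
  haveI : FiniteDimensional ℚ W := Submodule.finiteDimensional_of_le inf_le_left
  haveI : FiniteDimensional ℚ U := Submodule.finiteDimensional_of_le inf_le_left
  have hWU_sup : W ⊔ U = V := by
    rw [hU, inf_comm, ← sup_inf_assoc_of_le U' (inf_le_left : W ≤ V), hU'.sup_eq_top, top_inf_eq]
  have hWU_disj : Disjoint W U := hU'.disjoint.mono_right inf_le_right
  have hUE_disj : Disjoint U Eq := by
    rw [disjoint_def]
    intro a haU haE
    exact (disjoint_def.mp hWU_disj) a ⟨inf_le_left (b := U') haU, haE⟩ haU
  -- dimensions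
  set k := Module.finrank ℚ W
  set m := Module.finrank ℚ U
  have hn : k + m = n := by
    have h1 := Submodule.finrank_sup_add_finrank_inf_eq W U
    rw [hWU_disj.eq_bot, finrank_bot, add_zero, hWU_sup] at h1
    rw [← h1, hV, finrank_span_eq_card hx, Fintype.card_fin]
  -- bases
  let bW := Module.finBasis ℚ W
  let bU := Module.finBasis ℚ U
  let y : Fin k → ℂ := fun i => (bW i : ℂ)
  let z : Fin m → ℂ := fun j => (bU j : ℂ)
  have hy_mem : ∀ i, y i ∈ M := fun i => ((bW i).2 : (bW i : ℂ) ∈ V ⊓ Eq).2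
  have hy_V : ∀ i, y i ∈ V := fun i => ((bW i).2 : (bW i : ℂ) ∈ V ⊓ Eq).1
  have hz_U : ∀ j, z j ∈ U := fun j => (bU j).2
  have hz_V : ∀ j, z j ∈ V := fun j => inf_le_left (b := U') (hz_U j)
  have hy_li : LinearIndependent ℚ y := bW.linearIndependent.map' W.subtype W.ker_subtype
  have hz_li : LinearIndependent ℚ z := bU.linearIndependent.map' U.subtype U.ker_subtype
  -- clearing denominators
  choose Ny hNy hNy_mem using fun i => exists_nsmul_mem_span_int x (hy_V i)
  choose Nz hNz hNz_mem using fun j => exists_nsmul_mem_span_int x (hz_V j)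
  let cy : Fin k → ℚˣ := fun i => Units.mk0 (Ny i : ℚ) (Nat.cast_ne_zero.mpr (hNy i))
  let cz : Fin m → ℚˣ := fun j => Units.mk0 (Nz j : ℚ) (Nat.cast_ne_zero.mpr (hNz j))
  let y' : Fin k → ℂ := fun i => (Ny i : ℚ) • y i
  let z' : Fin m → ℂ := fun j => (Nz j : ℚ) • z j
  have hy'_eq : cy • y = y' := by
    funext i; simp only [Pi.smul_apply', cy, y', Units.smul_def, Units.val_mk0]
  have hz'_eq : cz • z = z' := by
    funext j; simp only [Pi.smul_apply', cz, z', Units.smul_def, Units.val_mk0]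
  have hy'_li : LinearIndependent ℚ y' := hy'_eq ▸ hy_li.units_smul cy
  have hz'_li : LinearIndependent ℚ z' := hz'_eq ▸ hz_li.units_smul cz
  have hy'_mem : ∀ i, y' i ∈ M := fun i => Eq.smul_mem _ (hy_mem i)
  have hz'_U : ∀ j, z' j ∈ U := fun j => U.smul_mem _ (hz_U j)
  have hz'_L : ∀ j, z' j ∈ L := fun j => hVL (inf_le_left (b := U') (hz'_U j))
  have hz'_modE : LinearIndependent ℚ ((span ℚ (M : Set ℂ)).mkQ ∘ z') := by
    refine hz'_li.map ?_
    rw [ker_mkQ, hspanE]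
    exact hUE_disj.mono_left (span_le.mpr (Set.range_subset_iff.mpr hz'_U))
  -- the field-theoretic estimate
  set Sy := Set.range y' ∪ Set.range (Complex.exp ∘ y') with hSy
  set Sz := Set.range z' ∪ Set.range (Complex.exp ∘ z') with hSz
  set Ky := adjoin ℚ Sy with hKy
  have hk : (k : Cardinal) ≤ Algebra.trdeg ℚ Ky := hA k y' hy'_mem hy'_li
  have hm₀ : (m : Cardinal) ≤ Algebra.trdeg M (adjoin M Sz) := hB m z' hz'_L hz'_modE
  have hKyM : Ky ≤ M := by
    rw [hKy, adjoin_le_iff]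
    rintro a (⟨i, rfl⟩ | ⟨i, rfl⟩)
    · exact hy'_mem i
    · exact hMexp _ (hy'_mem i)
  have hm : (m : Cardinal) ≤ Algebra.trdeg Ky (adjoin Ky Sz) :=
    hm₀.trans (trdeg_adjoin_le_of_le hKyM Sz)
  have hkm : (k : Cardinal) + m ≤ Algebra.trdeg ℚ (adjoin ℚ (Sy ∪ Sz)) :=
    add_le_trdeg_adjoin_union Sy Sz hk hm
  -- comparison with `ℚ(x̄, e^{x̄})`
  set Kx := adjoin ℚ (Set.range x ∪ Set.range (Complex.exp ∘ x)) with hKx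
  have hle : adjoin ℚ (Sy ∪ Sz) ≤ Kx := by
    rw [adjoin_le_iff]
    rintro a ((⟨i, rfl⟩ | ⟨i, rfl⟩) | (⟨j, rfl⟩ | ⟨j, rfl⟩))
    · exact (mem_adjoin_of_mem_span_int x (hNy_mem i)).1
    · exact (mem_adjoin_of_mem_span_int x (hNy_mem i)).2
    · exact (mem_adjoin_of_mem_span_int x (hNz_mem j)).1
    · exact (mem_adjoin_of_mem_span_int x (hNz_mem j)).2
  have hfin : Algebra.trdeg ℚ (adjoin ℚ (Sy ∪ Sz)) ≤ Algebra.trdeg ℚ Kx :=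
    trdeg_le_of_injective (inclusion hle) (inclusion_injective hle)
  calc (n : Cardinal) = (k : Cardinal) + m := by rw [← hn, Nat.cast_add]
    _ ≤ Algebra.trdeg ℚ (adjoin ℚ (Sy ∪ Sz)) := hkm
    _ ≤ Algebra.trdeg ℚ Kx := hfin

end HorizontalSplit

/-! ## The registered stub -/

/-- **Registered stub `stub_horizontalSplit` (S1a) of line `generic-period-fibre`** (signature
verbatim): for intermediate fields `M, L` of `ℂ/ℚ` with `M` closed under `exp`, Schanuel's
statement for `ℚ`-linearly independent tuples from `M` and relative Schanuel of `L` over `M`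
(tuples from `L` independent modulo `M` have `n ≤ trdeg_M M(x, eˣ)`) imply Schanuel's statement
for `ℚ`-linearly independent tuples from `L`.  At `M = kernelFreeCore`, `L = logFreeCore` this is
the line's composition `A ∧ B ⟹ (R)`.  Proof: `HorizontalSplit.schanuelOn_of_relSchanuel`. -/
theorem stub_horizontalSplit :
    ∀ (M L : IntermediateField ℚ ℂ), (∀ w ∈ M, Complex.exp w ∈ M) →
      (∀ (n : ℕ) (x : Fin n → ℂ), (∀ i, x i ∈ M) → LinearIndependent ℚ x →
        (n : Cardinal) ≤ Algebra.trdeg ℚ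
          ↥(IntermediateField.adjoin ℚ (Set.range x ∪ Set.range (Complex.exp ∘ x)))) →
      (∀ (n : ℕ) (x : Fin n → ℂ), (∀ i, x i ∈ L) →
        LinearIndependent ℚ ((Submodule.span ℚ (M : Set ℂ)).mkQ ∘ x) →
          (n : Cardinal) ≤ Algebra.trdeg ↥M
            ↥(IntermediateField.adjoin ↥M (Set.range x ∪ Set.range (Complex.exp ∘ x)))) →
      ∀ (n : ℕ) (x : Fin n → ℂ), (∀ i, x i ∈ L) → LinearIndependent ℚ x →
        (n : Cardinal) ≤ Algebra.trdeg ℚ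
          ↥(IntermediateField.adjoin ℚ (Set.range x ∪ Set.range (Complex.exp ∘ x))) :=
  fun _ _ hMexp hA hB n x hxL hx => HorizontalSplit.schanuelOn_of_relSchanuel hMexp hA hB n x hxL hx

end Summit.Schanuel.Schanuel.Theorems.RigidCore

end
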